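import Summits.Ventures.GridStability.Models.NE39LFaultOnBus37TubeLegsA
import Summits.Ventures.GridStability.Models.NE39LFaultOnBus37TubeLegsB
import Summits.Ventures.GridStability.Models.NE39LFaultOnBus37TubeLegsC

/-!
# NE39LFaultOnBus37Tube — THE 40-LEG KERNEL FAULT-ON TUBE of the New England 10-machine model «NE39L Padiyar Table 4.1 case 1: bus 37 grounded, no line tripped» (t ∈ [0, 0.2] s)

Venture GRIDFUSION (LADDER-GRIDFUSION G1-cct next wave «G1cct-NE39-TUBE», lead g8 RULINGs 9aa (3) / 9ar (1) / 9as; seat gridfusion-model-1 g8).  PROOF-ONLY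
ASSEMBLY of the three shard theorems (`legsA/B/C_chainOK`, `kboxAt_legsA/B/C`) by `SwingTube.chainOK_append` at the literal junction boxes `K14`, `K27`
⇒ `legs40_chainOK`; then
the generic integrator's theorems BY NAME (`SwingTube.tube_of_chainOK`, `SwingTube.clearingState_of_chainOK`, model-1 g6 p540594):

* `tube40` — for `k < 40`, `T ∈ [k/200, (k+1)/200]` and every solution `Y` of the FAULT-ON model `NE39L.FaultBus37.model` on `[0, T]` that starts AT
  THE SYNCHRONOUS EQUILIBRIUM of the model of record M′ (`δ_i(0) − δ_0(0) = θ*_i`, all `ω_i(0) = 0`): the state at `k/200` lies in the K-box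
  `kboxAt bus37K0 legs40 k` (translated angles `δ_i − δ_0(0)`, speeds) and for every `t ∈ [k/200, T]` in the re-based tube of leg `k`
  (`L_i s ≤ ω_i(t) − ω_i(k/200) ≤ H_i s`, `L_i s²/2 ≤ δ_i(t) − δ_i(k/200) − ω_i(k/200)s ≤ H_i s²/2`, `s = t − k/200`);
* `clearingState40` — the state at any clearing time `T ∈ [k/200 + sa, k/200 + sb]` lies in the SIGN-FREE slice box
  `(legAt legs40 k).sliceBox (kboxAt bus37K0 legs40 k) sa sb` (relative angles `δ_i − δ_0`, speeds; min/max hull formulas) whenever the slice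
  passes `sliceOK` — the receptacle for a future «K ⊂ S» consumer;
* `finalBox40` — the K-box at `0.2 s` is the literal `K40` (box centres: angle advance `δ_i(0.2) − δ_i(0)` of the ten machines ≈
  [-0.019, 0.019, 0.050, 0.078, 0.100, 0.103, 0.116, 0.021, 0.175, -0.257] rad (index 0 = GEN 2), speeds ≈ [-0.21, 0.15, 0.43, 0.79, 0.96, 1.02, 1.12, -0.08, 1.62, -1.98] rad/s;
  box widths ≤ 0.0082 rad / 0.122 rad/s).

HONEST LIMIT: a FAULT-TRAJECTORY enclosure for MODEL M′_F, not a clearing-time bound — whether any clearing state lies in a level set {V ≤ c₀} of the LFF certificates of record of M′ (`Lyapunov/NE39LLffLevel.lean`: c₀ < (2/λ + λ/2)·L_U, L_U = −67.244; L_oso = −467.416) is NOT tested here (the receptacle is `clearingState40`); no «K ⊂ S» test is made here.  LABEL OF EVERY MENTION (lead, inherited from the NE39L lane): «synthetic VARIANT (conductances dropped, lossless REDISPATCH at the printed operating angles), not a sentence about the printed New England system»; tokens MV-2L + MV-RD + MV-λ(1/10) + MV-h12 (+ E6, ω_R = 377).  MODELLED (three columns): M′_F = the FAULT-ON companion of the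 LFF-lane model of record M′ = `NE39L.data.toModelRel (1/10) a′` (model-1 `Models/NE39L.lean` p486685; ROA / level certificates of record LFF-P2 `Lyapunov/NE39LLffRoa.lean`, LFF-P2-LEVEL `Lyapunov/NE39LLffLevel.lean`), `a′ = 0`, with the susceptance couplings replaced by the h12 couplings `K^B,F` of the EXACT fault-on Kron reduction «bus 37 grounded» (lossless 39-bus lines, loads as admittances, faulted bus GROUNDED) and — MV-2L applied to the fault-on network as to the pre-fault one — the fault-on transfer conductances `D^F` and self-conductances `E_i²G^F_ii` DROPPED; model-4's two MODELLED features verbatim: (a) «COI acceleration ≡ 0 (lossless redispatch)»; (b) «for cases 3–6 the post-fault SEP ≠ the initial condition and P_mech is redispatched — the tube must land in {V_post ≤ L} of THAT object» (case 1: post = pre, so (b) is moot).  CERTIFIED = tube sentences for M′_F only; VALIDATED = nothing here (Padiyar's printed classical CCT 0.21–0.22 s of case 1, Table 4.2, is a comparator for the LOSSY printed model in `bench/data/NE39/validated-Padiyar2013.json`, never for this variant).  CCT statements built on this tube would be MODEL statements (inner estimates), never the system's CCT.  No sentence of this file says a machine or a grid is stable; this is a trajectory ENCLOSURE.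
[cite: Moore1979, §8.1 eqs. (8.5), (8.10); Padiyar2013, Table 4.1]
-/

noncomputable section

open Real Set

namespace Summit.Ventures.GridStability.Models

namespace NE39L

namespace FaultBus37

/-- **KERNEL (assembled): the 40-leg chain check passes from the initial box** — shards A, B, C at the junction boxes `K14`, `K27`. -/
theorem legs40_chainOK : SwingTube.chainOK bus37Q bus37K0 legs40 = true := by
  rw [legs40, SwingTube.chainOK_append, legsA_chainOK, legsA_length, kboxAt_legsA, SwingTube.chainOK_append, legsB_chainOK,
    legsB_length, kboxAt_legsB, legsC_chainOK]
  rfl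

/-- Start times `start_k = k/200 s`. -/
theorem legs40_startAt : ∀ k : Fin 41, SwingTube.startAt 0 legs40 k = (k : ℚ) / 200 := by
  decide +kernel

/-- Every leg lasts `1/200 s`. -/
theorem legs40_τ : ∀ k : Fin 40, (SwingTube.legAt legs40 k).τ = 1 / 200 := by
  decide +kernel

/-- **The box at 0.2 s is the literal `K40`.** -/
theorem finalBox40 : SwingTube.kboxAt bus37K0 legs40 40 = K40 := by
  have hA := SwingTube.kboxAt_append legsA (legsB ++ legsC) bus37K0 26
  have hB := SwingTube.kboxAt_append legsB legsC K14 13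
  rw [legsA_length, kboxAt_legsA] at hA
  rw [legsB_length, kboxAt_legsB] at hB
  rw [legs40, show (40 : ℕ) = 14 + 26 from rfl, hA, show (26 : ℕ) = 13 + 13 from rfl, hB,
    kboxAt_legsC]

/-- **THE 40-LEG FAULT-ON TUBE.**  For `k < 40`, `T ∈ [k/200, (k+1)/200]`, every solution `Y` of the fault-on model `model` on `[0, T]` from the
synchronous equilibrium of M′ (relative angles `θ*`, all speeds `0`): the state at `k/200` lies in `kboxAt bus37K0 legs40 k` and, for every
`t ∈ [k/200, T]`, in the re-based tube of leg `k`.  LABEL OF EVERY MENTION (lead, inherited from the NE39L lane): «synthetic VARIANT (conductances dropped, lossless REDISPATCH at the printed operating angles), not a sentence about the printed New England system»; tokens MV-2L + MV-RD + MV-λ(1/10) + MV-h12 (+ E6, ω_R = 377).  MODELLED (three columns): M′_F = the FAULT-ON companion of the LFF-lane model of record M′ = `NE39L.data.toModelRel (1/10) a′` (model-1 `Models/NE39L.lean` p486685; ROA / level certificates of record LFF-P2 `Lyapunov/NE39LLffRoa.lean`, LFF-P2-LEVEL `Lyapunov/NE39LLffLevel.lean`), `a′ = 0`, with the susceptance couplings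 replaced by the h12 couplings `K^B,F` of the EXACT fault-on Kron reduction «bus 37 grounded» (lossless 39-bus lines, loads as admittances, faulted bus GROUNDED) and — MV-2L applied to the fault-on network as to the pre-fault one — the fault-on transfer conductances `D^F` and self-conductances `E_i²G^F_ii` DROPPED; model-4's two MODELLED features verbatim: (a) «COI acceleration ≡ 0 (lossless redispatch)»; (b) «for cases 3–6 the post-fault SEP ≠ the initial condition and P_mech is redispatched — the tube must land in {V_post ≤ L} of THAT object» (case 1: post = pre, so (b) is moot).  CERTIFIED = tube sentences for M′_F only; VALIDATED = nothing here (Padiyar's printed classical CCT 0.21–0.22 s of case 1, Table 4.2, is a comparator for the LOSSY printed model in `bench/data/NE39/validated-Padiyar2013.json`, never for this variant).  CCT statements built on this tube would be MODEL statements (inner estimates), never the system's CCT.  No sentence of this file says a machine or a grid is stable; this is a trajectory ENCLOSURE. [cite: Moore1979, §8.1 eq. (8.10)] -/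
theorem tube40 {k : ℕ} (hk : k < 40) {T : ℝ} (hT1 : (k : ℝ) / 200 ≤ T) (hT2 : T ≤ ((k : ℝ) + 1) / 200)
    {Y : ℝ → ClassicalSwing.State 10} (hY : model.IsSolutionOn Y (Icc 0 T)) (hω0 : (Y 0).2 = 0)
    (hδ0 : ∀ i, (Y 0).1 i - (Y 0).1 0 = data.angleOf i) :
    Y ((k : ℝ) / 200) ∈ (SwingTube.kboxAt bus37K0 legs40 k).toSet ((Y 0).1 0) ∧
      ∀ t ∈ Icc ((k : ℝ) / 200) T,
        Y t ∈ (SwingTube.legAt legs40 k).tubeSet (Y ((k : ℝ) / 200)) (t - (k : ℝ) / 200) := by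
  have hk' : k < legs40.length := by rw [legs40_length]; exact hk
  have hs : SwingTube.startAt 0 legs40 k = (k : ℚ) / 200 := legs40_startAt ⟨k, by omega⟩
  have hτ : (SwingTube.legAt legs40 k).τ = 1 / 200 := legs40_τ ⟨k, hk⟩
  have e1 : ((SwingTube.startAt 0 legs40 k : ℚ) : ℝ) = (k : ℝ) / 200 := by rw [hs]; push_cast; ring
  have h0 : Y 0 ∈ bus37K0.toSet ((Y 0).1 0) := K0_holds hω0 hδ0
  have h := SwingTube.tube_of_chainOK legs40_chainOK hk' (T := T) (by rw [e1]; exact hT1)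
    (by rw [e1, hτ]; push_cast; linarith) hY h0
  rw [e1] at h
  exact h

/-- **THE CLEARING STATE in the sign-free slice box.**  For `k < 40`, a slice `(sa, sb)` of leg `k` passing `sliceOK`, `T ∈ [k/200 + sa, k/200 + sb]`
and every fault-on solution `Y` as in `tube40`: `Y T ∈ ((legAt legs40 k).sliceBox (kboxAt bus37K0 legs40 k) sa sb).toSet` (relative angles
`δ_i − δ_0`, speeds).  LABEL OF EVERY MENTION (lead, inherited from the NE39L lane): «synthetic VARIANT (conductances dropped, lossless REDISPATCH at the printed operating angles), not a sentence about the printed New England system»; tokens MV-2L + MV-RD + MV-λ(1/10) + MV-h12 (+ E6, ω_R = 377).  MODELLED (three columns): M′_F = the FAULT-ON companion of the LFF-lane model of record M′ = `NE39L.data.toModelRel (1/10) a′` (model-1 `Models/NE39L.lean` p486685; ROA / level certificates of record LFF-P2 `Lyapunov/NE39LLffRoa.lean`, LFF-P2-LEVEL `Lyapunov/NE39LLffLevel.lean`), `a′ = 0`, with the susceptance couplings replaced by the h12 couplings `K^B,F` of the EXACT fault-on Kron reduction «bus 37 grounded» (lossless 39-bus lines, loads as admittances, faulted bus GROUNDED)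 and — MV-2L applied to the fault-on network as to the pre-fault one — the fault-on transfer conductances `D^F` and self-conductances `E_i²G^F_ii` DROPPED; model-4's two MODELLED features verbatim: (a) «COI acceleration ≡ 0 (lossless redispatch)»; (b) «for cases 3–6 the post-fault SEP ≠ the initial condition and P_mech is redispatched — the tube must land in {V_post ≤ L} of THAT object» (case 1: post = pre, so (b) is moot).  CERTIFIED = tube sentences for M′_F only; VALIDATED = nothing here (Padiyar's printed classical CCT 0.21–0.22 s of case 1, Table 4.2, is a comparator for the LOSSY printed model in `bench/data/NE39/validated-Padiyar2013.json`, never for this variant).  CCT statements built on this tube would be MODEL statements (inner estimates), never the system's CCT.  No sentence of this file says a machine or a grid is stable; this is a trajectory ENCLOSURE. [cite: Moore1979, §8.1 eq. (8.10)] -/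
theorem clearingState40 {k : ℕ} (hk : k < 40) {sa sb : ℚ} (hs : (SwingTube.legAt legs40 k).sliceOK sa sb = true) {T : ℝ}
    (hT1 : (k : ℝ) / 200 + (sa : ℝ) ≤ T) (hT2 : T ≤ (k : ℝ) / 200 + (sb : ℝ))
    {Y : ℝ → ClassicalSwing.State 10} (hY : model.IsSolutionOn Y (Icc 0 T)) (hω0 : (Y 0).2 = 0)
    (hδ0 : ∀ i, (Y 0).1 i - (Y 0).1 0 = data.angleOf i) :
    Y T ∈ ((SwingTube.legAt legs40 k).sliceBox (SwingTube.kboxAt bus37K0 legs40 k) sa sb).toSet := by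
  have hk' : k < legs40.length := by rw [legs40_length]; exact hk
  have hst : SwingTube.startAt 0 legs40 k = (k : ℚ) / 200 := legs40_startAt ⟨k, by omega⟩
  have e1 : ((SwingTube.startAt 0 legs40 k : ℚ) : ℝ) = (k : ℝ) / 200 := by rw [hst]; push_cast; ring
  have h0 : Y 0 ∈ bus37K0.toSet ((Y 0).1 0) := K0_holds hω0 hδ0
  exact SwingTube.clearingState_of_chainOK legs40_chainOK hk' hs (T := T) (by rw [e1]; exact hT1) (by rw [e1]; exact hT2) hY h0

end FaultBus37

end NE39L

end Summit.Ventures.GridStability.Models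

end
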